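import Summits.Ventures.QEC.Thresholds.RotatedSurfaceCodeSAWThresholdsDual
import Summits.Ventures.QEC.Thresholds.PhenomenologicalThresholdConverses
import HarnessLib

/-!
# Rotated surface codes: certified two-sided WINDOWS — odd distance: `p₀(2.6939) ≤ p_c ≤ 1/4` per sector,
# `(3/2)·p₀ ≤ p_c^depol ≤ 3/8`, noisy measurement `p₀(5) ≤ p_c^{ph} ≤ 1/4` (ceilings for EVERY decoder); every size: the
# two-sector sum ceilings — tier CERTIFIED (kernel)

Venture QEC, `Summits/Ventures/QEC/Thresholds/` (LADDER-QEC rung Q5, PARTITION row 09; qec-type-09 gen 6, cell item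
«09.RSCSAWZ», HONEST-FRAMING complement). lit-2's `ThresholdConverses.lean` / `DepolarizingThresholdConverses.lean` /
`PlanarThresholdConverses.lean` bound every certified threshold of a CSS family with `k ≥ 1` from ABOVE: the two
sectors' code-capacity floors sum to `≤ 1/2`, the erasure floors to `≤ 1`, the depolarizing threshold is `≤ 3/8`
(erasure-decomposition / no-cloning); when the `X ↔ Z` exchange is a re-indexing, each sector alone gets `p_c ≤ 1/4`,
`y_c ≤ 1/2`. For the rotated surface codes (`k = 1`, type-08's `RotatedSurface.code_k`):

* every size `RSC(i+1)`: the SUM ceiling `p_c^Z + p_c^X ≤ 1/2` and `p_c^depol ≤ 3/8` for EVERY pair of decoder families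
  (`rsc_capacityAccuracyThreshold_sum_le_half`, `rsc_depolarizing_accuracyThreshold_le_three_eighths`), hence the window
  `(3/2)·p₀(3) ≤ p_c^depol ≤ 3/8` with item 143's floor (`rsc_depolarizing_accuracyThreshold_mem`);
* odd sizes `RSC(2i+1)` (the quarter turn `RotatedSurface.code_swap_eq_reindex` exchanges the sectors): the two erasure
  families COINCIDE pointwise (`rsc_odd_xErasureFamily_eq`; the loss threshold itself is `1/2` EXACTLY in both sectors and
  every size — type-03's `RotatedSurfaceLossThresholdHalf.lean`, not restated); every `Z`-decoder family transports to an
  `X`-decoder family with the same failure family (`rsc_odd_xFailureFamily_transport_eq`) and conversely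
  (`rsc_xFailureFamily_odd_eq_pullback`), so **`p_c ≤ 1/4` for EVERY decoder family of either sector** (maximum
  likelihood included) and **`p₀(2.6939) ≤ p_c ≤ 1/4`** (`.0357 < p_c ≤ .25`) under minimum-weight decoding
  (`rsc_odd_z_capacity_accuracyThreshold_mem`, `…_x_…`); depolarizing **`(3/2)·p₀(2.6939) ≤ p_c^depol ≤ 3/8`**
  (`.0535 < p_c^depol ≤ .375`, `rsc_odd_depolarizing_accuracyThreshold_mem`);
* odd sizes, NOISY syndrome measurement (`q = p`, schedules `T_i ≥ 1`): the erasure coincidence also gives lit-2's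
  phenomenological ceiling — **`p_c^{ph} ≤ 1/4` for EVERY space-time decoder family** in both records
  (`rsc_odd_z/x_phenom_threshold_le_quarter`) — and with item 143's generic floor re-instantiated along the odd subfamily
  (`rsc_odd_z/x_phenom_isThresholdLowerBound`, growth `rsc_odd_phenom_growth_z/x`) the window **`p₀(5) ≤ p_c^{ph} ≤ 1/4`**
  (`.0101 < p_c^{ph} ≤ .25`) for polynomially many rounds (`rsc_odd_z/x_phenom_accuracyThreshold_mem`); every size:
  `p_c^{ph,Z} + p_c^{ph,X} ≤ 1/2` (`rsc_phenomAccuracyThreshold_sum_le_half`).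

Printed surface-code values (VALIDATED column, NOT theorems; as quoted in `PlanarThresholdConverses.lean`): optimal
`p_c ≈ .109`, MWPM `≈ .103`. Kernel axioms only; no named fact; no `native_decide`.

## References

* [RichardsonUrbanke2008] T. Richardson, R. Urbanke, *Modern Coding Theory*, CUP 2008, Lemma 4.78 (Erasure Decomposition).
* [StaceBarrettDoherty2009] T. M. Stace, S. D. Barrett, A. C. Doherty, PRL 102 (2009) 200501, pp. 1–2 (no-cloning bound).
* [DumerKovalevPryadko2015] I. Dumer, A. A. Kovalev, L. P. Pryadko, PRL 115 (2015) 050502, Thm 2, p. 5.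
* [DennisEtAl2002] E. Dennis, A. Kitaev, A. Landahl, J. Preskill, J. Math. Phys. 43 (2002) 4452, §4.1, §4.6, §5.3.
* [LinPryadko2024] H.-K. Lin, L. P. Pryadko, PRA 109 (2024) 022407, §4.2 Thm 6 (permutation-equivalent CSS codes).
-/

noncomputable section

namespace Summit.Ventures.QEC.Thresholds

open Filter Topology Finset Matrix
open Literature.InformationTheory.QuantumCodes
open Literature.InformationTheory.QuantumCodes.RotatedSurface
open Literature.Probability.RandomPlanarGeometry

/-! ### Every size: one logical qubit, the sum ceilings, the depolarizing ceiling -/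

/-- `k(RSC(i+1)) = 1 > 0`. [cite: DumerKovalevPryadko2015, Thm 2 (k ≥ 1 codes)] -/
theorem rsc_k_pos (i : ℕ) : 0 < (rscCode i).k := by
  rw [show (rscCode i).k = 1 from RotatedSurface.code_k (by omega)]
  norm_num

/-- `k(RSC(2i+1)) > 0`. [cite: DumerKovalevPryadko2015, Thm 2] -/
theorem rscOdd_k_pos (i : ℕ) : 0 < (rscOddCode i).k := rsc_k_pos (2 * i)

/-- **`p_c^Z + p_c^X ≤ 1/2` for the rotated surface codes**, ANY pair of decoder families (every size).
[cite: RichardsonUrbanke2008, Lemma 4.78 (Erasure Decomposition Lemma)] -/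
theorem rsc_capacityAccuracyThreshold_sum_le_half
    (DZ : ∀ i, Decoder (Fin (i + 1 + 1) × Fin (i + 1 - 1) → ZMod 2) (Fin (i + 1) × Fin (i + 1) → ZMod 2))
    (DX : ∀ i, Decoder (Fin (i + 1 - 1) × Fin (i + 1 + 1) → ZMod 2) (Fin (i + 1) × Fin (i + 1) → ZMod 2)) :
    accuracyThreshold (zFailureFamily rscCode DZ) + accuracyThreshold (xFailureFamily rscCode DX) ≤ 1 / 2 :=
  capacityAccuracyThreshold_sum_le_half rscCode rsc_k_pos DZ DX

/-- **`p_c^depol ≤ 3/8` for the rotated surface codes**, ANY pair of sector decoders (every size).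
[cite: DennisEtAl2002, §4.1 and §4.6] [cite: RichardsonUrbanke2008, Lemma 4.78] -/
theorem rsc_depolarizing_accuracyThreshold_le_three_eighths
    (DX : ∀ i, Decoder (Fin (i + 1 - 1) × Fin (i + 1 + 1) → ZMod 2) (Fin (i + 1) × Fin (i + 1) → ZMod 2))
    (DZ : ∀ i, Decoder (Fin (i + 1 + 1) × Fin (i + 1 - 1) → ZMod 2) (Fin (i + 1) × Fin (i + 1) → ZMod 2)) :
    accuracyThreshold (depolarizingFailureFamily rscCode DX DZ) ≤ 3 / 8 :=
  depolarizingAccuracyThreshold_le_three_eighths rscCode rsc_k_pos DX DZ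

/-- **`p_c^{ph,Z} + p_c^{ph,X} ≤ 1/2` for the rotated surface codes** with noisy syndrome measurement (`q = p`), ANY schedules
`T_i, T'_i ≥ 1` and ANY space-time decoder families (every size). [cite: DennisEtAl2002, §4.6 and §5.3] -/
theorem rsc_phenomAccuracyThreshold_sum_le_half (T T' : ℕ → ℕ) (hT : ∀ i, 0 < T i) (hT' : ∀ i, 0 < T' i)
    (DZ : ∀ i, CSSPhenom.STDecoder (Fin (i + 1 + 1) × Fin (i + 1 - 1)) (Fin (i + 1) × Fin (i + 1)) (T i))
    (DX : ∀ i, CSSPhenom.STDecoder (Fin (i + 1 - 1) × Fin (i + 1 + 1)) (Fin (i + 1) × Fin (i + 1)) (T' i)) :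
    accuracyThreshold (zPhenomFailureFamily rscCode T DZ) + accuracyThreshold (xPhenomFailureFamily rscCode T' DX) ≤ 1 / 2 :=
  phenomAccuracyThreshold_sum_le_half rscCode rsc_k_pos T T' hT hT' DZ DX

/-- **`(3/2)·p₀(3) ≤ p_c^depol ≤ 3/8` for every size** under sector-wise minimum-weight decoding (floor: item 143).
[cite: DennisEtAl2002, §4.1 and §4.6] [cite: DumerKovalevPryadko2015, Thm 2 (w = 4)] -/
theorem rsc_depolarizing_accuracyThreshold_mem
    (DX : ∀ i, Decoder (Fin (i + 1 - 1) × Fin (i + 1 + 1) → ZMod 2) (Fin (i + 1) × Fin (i + 1) → ZMod 2))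
    (DZ : ∀ i, Decoder (Fin (i + 1 + 1) × Fin (i + 1 - 1) → ZMod 2) (Fin (i + 1) × Fin (i + 1) → ZMod 2))
    (hDX : ∀ i, (DX i).IsMinWeight (rscCode i).xSyndrome ((rscCode i).kerZ : Set _) hammingNorm)
    (hDZ : ∀ i, (DZ i).IsMinWeight (rscCode i).zSyndrome ((rscCode i).kerX : Set _) hammingNorm) :
    3 / 2 * thresholdValue 3 ≤ accuracyThreshold (depolarizingFailureFamily rscCode DX DZ) ∧
      accuracyThreshold (depolarizingFailureFamily rscCode DX DZ) ≤ 3 / 8 := by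
  refine ⟨le_accuracyThreshold (rsc_depolarizing_isThresholdLowerBound DX DZ hDX hDZ) ?_,
    rsc_depolarizing_accuracyThreshold_le_three_eighths DX DZ⟩
  have := thresholdValue_le_half (3 : ℝ)
  linarith

/-! ### Odd sizes: the two erasure families coincide -/

/-- **The two sectors of `RSC(2i+1)` have the same erasure family** (pointwise): the exchange is the quarter-turn
re-indexing and uncorrectable-erasure probabilities are re-indexing invariant. [cite: LinPryadko2024, §4.2 Thm 6]
[cite: StaceBarrettDoherty2009, p. 2 (losses affect both logical operators symmetrically)] -/
theorem rsc_odd_xErasureFamily_eq (i : ℕ) (y : ℝ) :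
    xErasureFamily rscOddCode i y = zErasureFamily rscOddCode i y := by
  rw [xErasureFamily_eq_swap]
  change ErasureDecoder.uncorrectableProb {x | (RotatedSurface.code (2 * i + 1)).swap.HX *ᵥ x = 0}
      ((RotatedSurface.code (2 * i + 1)).swap.rowSpZ : Set _) y =
    ErasureDecoder.uncorrectableProb {x | (RotatedSurface.code (2 * i + 1)).HX *ᵥ x = 0}
      ((RotatedSurface.code (2 * i + 1)).rowSpZ : Set _) y
  rw [code_swap_eq_reindex (odd_two_mul_add_one i), CSSCode.uncorrectableProb_reindex]

/-- Family form: `xErasureFamily rscOddCode = zErasureFamily rscOddCode`. [cite: StaceBarrettDoherty2009, p. 2] -/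
theorem rsc_odd_xErasureFamily_eq_zErasureFamily : xErasureFamily rscOddCode = zErasureFamily rscOddCode := by
  funext i y
  exact rsc_odd_xErasureFamily_eq i y

/-! ### Odd sizes: `p_c ≤ 1/4` for EVERY decoder family of either sector; the windows -/

/-- **Transport of a `Z`-decoder of `RSC(L)` to an `X`-decoder** along the quarter turn: `s' ↦ DZ(s' ∘ qturn⁻¹) ∘ qturn`.
[cite: LinPryadko2024, §4.2 Thm 6 (permutation-equivalent codes)] -/
def rscQturnTransport (L : ℕ) (DZ : Decoder (Fin (L + 1) × Fin (L - 1) → ZMod 2) (Fin L × Fin L → ZMod 2)) :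
    Decoder (Fin (L - 1) × Fin (L + 1) → ZMod 2) (Fin L × Fin L → ZMod 2) :=
  fun s' => DZ (s' ∘ ⇑(qturn (L - 1) (L + 1)).symm) ∘ ⇑(qturn L L)

open Classical in
/-- **The transported decoder has the same failure family** (odd sizes): the `X`-sector failure family of the transports
equals the `Z`-sector failure family of `DZ`. [cite: LinPryadko2024, §4.2 Thm 6] [cite: StaceBarrettDoherty2009, p. 2] -/
theorem rsc_odd_xFailureFamily_transport_eq
    (DZ : ∀ i, Decoder (Fin (2 * i + 1 + 1) × Fin (2 * i + 1 - 1) → ZMod 2) (Fin (2 * i + 1) × Fin (2 * i + 1) → ZMod 2)) :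
    xFailureFamily rscOddCode (fun i => rscQturnTransport (2 * i + 1) (DZ i)) = zFailureFamily rscOddCode DZ := by
  funext i p
  rw [xFailureFamily_eq_swap]
  change (∑ e ∈ univ.filter (fun e => ¬ Decoder.Corrects (rscQturnTransport (2 * i + 1) (DZ i))
        (RotatedSurface.code (2 * i + 1)).swap.zSyndrome ((RotatedSurface.code (2 * i + 1)).swap.rowSpZ : Set _) e),
        bernoulliWeight p (supp e)) =
    ∑ e ∈ univ.filter (fun e => ¬ (DZ i).Corrects (RotatedSurface.code (2 * i + 1)).zSyndrome
        ((RotatedSurface.code (2 * i + 1)).rowSpZ : Set _) e), bernoulliWeight p (supp e)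
  rw [code_swap_eq_reindex (odd_two_mul_add_one i)]
  exact CSSCode.zFailure_reindex (RotatedSurface.code (2 * i + 1)) (qturn _ _).symm (qturn _ _).symm (qturn _ _).symm
    (DZ i) p

/-- ★ **`p_c ≤ 1/4` for EVERY decoder family of the `H_X` sector of `RSC(2i+1)`** (maximum likelihood included).
[cite: RichardsonUrbanke2008, Lemma 4.78 (Erasure Decomposition Lemma)] [cite: StaceBarrettDoherty2009, p. 2] -/
theorem rsc_odd_z_capacity_threshold_le_quarter
    (DZ : ∀ i, Decoder (Fin (2 * i + 1 + 1) × Fin (2 * i + 1 - 1) → ZMod 2) (Fin (2 * i + 1) × Fin (2 * i + 1) → ZMod 2))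
    {a : ℝ} (ha : IsThresholdLowerBound (zFailureFamily rscOddCode DZ) a) : a ≤ 1 / 4 := by
  have hb : IsThresholdLowerBound (xFailureFamily rscOddCode fun i => rscQturnTransport (2 * i + 1) (DZ i)) a := by
    rw [rsc_odd_xFailureFamily_transport_eq]
    exact ha
  have h := capacity_thresholds_add_le_half rscOddCode rscOdd_k_pos DZ _ ha hb
  linarith

/-- ★ **`p_c ≤ 1/4` for EVERY decoder family of the `H_Z` sector of `RSC(2i+1)`.**
[cite: RichardsonUrbanke2008, Lemma 4.78 (Erasure Decomposition Lemma)] [cite: StaceBarrettDoherty2009, p. 2] -/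
theorem rsc_odd_x_capacity_threshold_le_quarter
    (DX : ∀ i, Decoder (Fin (2 * i + 1 - 1) × Fin (2 * i + 1 + 1) → ZMod 2) (Fin (2 * i + 1) × Fin (2 * i + 1) → ZMod 2))
    {b : ℝ} (hb : IsThresholdLowerBound (xFailureFamily rscOddCode DX) b) : b ≤ 1 / 4 := by
  have ha : IsThresholdLowerBound (zFailureFamily rscOddCode fun i => rscQturnPullback (2 * i + 1) (DX i)) b := by
    rw [← rsc_xFailureFamily_odd_eq_pullback]
    exact hb
  have h := capacity_thresholds_add_le_half rscOddCode rscOdd_k_pos _ DX ha hb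
  linarith

/-- `p_c ≤ 1/4`, accuracy-threshold form, `H_X` sector of `RSC(2i+1)`, every decoder family.
[cite: RichardsonUrbanke2008, Lemma 4.78] -/
theorem rsc_odd_z_capacity_accuracyThreshold_le_quarter
    (DZ : ∀ i, Decoder (Fin (2 * i + 1 + 1) × Fin (2 * i + 1 - 1) → ZMod 2) (Fin (2 * i + 1) × Fin (2 * i + 1) → ZMod 2)) :
    accuracyThreshold (zFailureFamily rscOddCode DZ) ≤ 1 / 4 :=
  rsc_odd_z_capacity_threshold_le_quarter DZ (isThresholdLowerBound_accuracyThreshold _)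

/-- `p_c ≤ 1/4`, accuracy-threshold form, `H_Z` sector of `RSC(2i+1)`, every decoder family.
[cite: RichardsonUrbanke2008, Lemma 4.78] -/
theorem rsc_odd_x_capacity_accuracyThreshold_le_quarter
    (DX : ∀ i, Decoder (Fin (2 * i + 1 - 1) × Fin (2 * i + 1 + 1) → ZMod 2) (Fin (2 * i + 1) × Fin (2 * i + 1) → ZMod 2)) :
    accuracyThreshold (xFailureFamily rscOddCode DX) ≤ 1 / 4 :=
  rsc_odd_x_capacity_threshold_le_quarter DX (isThresholdLowerBound_accuracyThreshold _)

/-- ★ **`p₀(2.6939) ≤ p_c ≤ 1/4`** (`.0357 < p_c ≤ .25`) for the `H_X` sector of the odd-distance rotated surface codes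
under any minimum-weight decoder family — a certified two-sided window (numerics: optimal `≈ .109`, MWPM `≈ .103`,
VALIDATED values, not theorems). [cite: DennisEtAl2002, §5.3 eq. (p_c_2d)] [cite: RichardsonUrbanke2008, Lemma 4.78] -/
theorem rsc_odd_z_capacity_accuracyThreshold_mem
    (D : ∀ i, Decoder (Fin (2 * i + 1 + 1) × Fin (2 * i + 1 - 1) → ZMod 2) (Fin (2 * i + 1) × Fin (2 * i + 1) → ZMod 2))
    (hD : ∀ i, (D i).IsMinWeight (rscOddCode i).zSyndrome ((rscOddCode i).kerX : Set _) hammingNorm) :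
    thresholdValue 2.6939 ≤ accuracyThreshold (zFailureFamily rscOddCode D) ∧
      accuracyThreshold (zFailureFamily rscOddCode D) ≤ 1 / 4 :=
  ⟨le_accuracyThreshold (rsc_z_odd_isThresholdLowerBound_kernelSymmK16 D hD)
      ((thresholdValue_le_half _).trans (by norm_num)),
    rsc_odd_z_capacity_accuracyThreshold_le_quarter D⟩

/-- ★ **`p₀(2.6939) ≤ p_c ≤ 1/4`** for the `H_Z` sector of the odd-distance rotated surface codes under any minimum-weight
decoder family. [cite: DennisEtAl2002, §5.3 eq. (p_c_2d)] [cite: RichardsonUrbanke2008, Lemma 4.78] -/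
theorem rsc_odd_x_capacity_accuracyThreshold_mem
    (D' : ∀ i, Decoder (Fin (2 * i + 1 - 1) × Fin (2 * i + 1 + 1) → ZMod 2) (Fin (2 * i + 1) × Fin (2 * i + 1) → ZMod 2))
    (hD' : ∀ i, (D' i).IsMinWeight (rscOddCode i).xSyndrome ((rscOddCode i).kerZ : Set _) hammingNorm) :
    thresholdValue 2.6939 ≤ accuracyThreshold (xFailureFamily rscOddCode D') ∧
      accuracyThreshold (xFailureFamily rscOddCode D') ≤ 1 / 4 :=
  ⟨le_accuracyThreshold (rsc_x_odd_isThresholdLowerBound_kernelSymmK16 D' hD')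
      ((thresholdValue_le_half _).trans (by norm_num)),
    rsc_odd_x_capacity_accuracyThreshold_le_quarter D'⟩

/-- ★ **`(3/2)·p₀(2.6939) ≤ p_c^depol ≤ 3/8`** (`.0535 < p_c^depol ≤ .375`) for the odd-distance rotated surface codes under
sector-wise minimum-weight decoding — a certified two-sided window. [cite: DennisEtAl2002, §4.1 and §4.6]
[cite: RichardsonUrbanke2008, Lemma 4.78] -/
theorem rsc_odd_depolarizing_accuracyThreshold_mem
    (DX : ∀ i, Decoder (Fin (2 * i + 1 - 1) × Fin (2 * i + 1 + 1) → ZMod 2) (Fin (2 * i + 1) × Fin (2 * i + 1) → ZMod 2))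
    (DZ : ∀ i, Decoder (Fin (2 * i + 1 + 1) × Fin (2 * i + 1 - 1) → ZMod 2) (Fin (2 * i + 1) × Fin (2 * i + 1) → ZMod 2))
    (hDX : ∀ i, (DX i).IsMinWeight (rscOddCode i).xSyndrome ((rscOddCode i).kerZ : Set _) hammingNorm)
    (hDZ : ∀ i, (DZ i).IsMinWeight (rscOddCode i).zSyndrome ((rscOddCode i).kerX : Set _) hammingNorm) :
    3 / 2 * thresholdValue 2.6939 ≤ accuracyThreshold (depolarizingFailureFamily rscOddCode DX DZ) ∧
      accuracyThreshold (depolarizingFailureFamily rscOddCode DX DZ) ≤ 3 / 8 := by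
  refine ⟨le_accuracyThreshold (rsc_odd_depolarizing_isThresholdLowerBound_kernelSymmK16 DX DZ hDX hDZ) ?_,
    depolarizingAccuracyThreshold_le_three_eighths rscOddCode rscOdd_k_pos DX DZ⟩
  have := thresholdValue_le_half (2.6939 : ℝ)
  linarith

/-! ### Odd sizes, noisy syndrome measurement (`q = p`): `p₀(5) ≤ p_c^{ph} ≤ 1/4` in both records -/

/-- Distance hypothesis along the odd subfamily, `Z`-logicals: weight `≥ 2i+1` (type-08's `code_dZ`). [cite: DennisEtAl2002, §3.2] -/
theorem rsc_odd_le_weight_z (i : ℕ) (x : Fin (2 * i + 1) × Fin (2 * i + 1) → ZMod 2) (hx : (rscOddCode i).HX *ᵥ x = 0)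
    (hxS : x ∉ (rscOddCode i).rowSpZ) : 2 * i + 1 ≤ hammingNorm x :=
  le_weight_of_le_dZ rscOddCode (d := fun i => 2 * i + 1) (fun i => (code_dZ (L := 2 * i + 1) (by omega)).symm.le) i x hx hxS

/-- Distance hypothesis along the odd subfamily, `X`-logicals. [cite: DennisEtAl2002, §3.2] -/
theorem rsc_odd_le_weight_x (i : ℕ) (x : Fin (2 * i + 1) × Fin (2 * i + 1) → ZMod 2) (hx : (rscOddCode i).HZ *ᵥ x = 0)
    (hxS : x ∉ (rscOddCode i).rowSpX) : 2 * i + 1 ≤ hammingNorm x :=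
  le_weight_of_le_dX rscOddCode (d := fun i => 2 * i + 1) (fun i => (code_dX (L := 2 * i + 1) (by omega)).symm.le) i x hx hxS

/-- **Growth with noisy rounds along the odd subfamily**: `(L² + (L+1)(L-1))·T(i)·r^L → 0`, `L = 2i+1`, for a polynomially
bounded schedule (`X`-checks). [cite: DennisEtAl2002, §5.3 (T increasing no faster than a polynomial of L)] -/
theorem rsc_odd_phenom_growth_z {T : ℕ → ℕ} (hT : ToricCode.IsPolyBounded T) (r : ℝ) (hr0 : 0 < r) (hr1 : r < 1) :
    Tendsto (fun i => (((Fintype.card (Fin (2 * i + 1) × Fin (2 * i + 1)) +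
      Fintype.card (Fin (2 * i + 1 + 1) × Fin (2 * i + 1 - 1))) * T i : ℕ) : ℝ) * r ^ (2 * i + 1)) atTop (𝓝 0) := by
  obtain ⟨A, m, hAm⟩ := hT
  have hA0 : 0 ≤ A := by
    have h := hAm 0
    simp only [Nat.cast_zero, zero_add, one_pow, mul_one] at h
    exact le_trans (Nat.cast_nonneg _) h
  have h0 := tendsto_pow_const_mul_const_pow_of_abs_lt_one (m + 2) (show |r| < 1 by rwa [abs_of_nonneg hr0.le])
  have h1 : Tendsto (fun i : ℕ => ((i + 1 : ℕ) : ℝ) ^ (m + 2) * r ^ (i + 1)) atTop (𝓝 0) :=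
    (Filter.tendsto_add_atTop_iff_nat 1).2 h0
  have h2 := h1.const_mul (9 * A)
  rw [mul_zero] at h2
  refine squeeze_zero (fun i => by positivity) (fun i => ?_) h2
  have hrk : 0 ≤ r ^ (2 * i + 1) := pow_nonneg hr0.le _
  have hrle : r ^ (2 * i + 1) ≤ r ^ (i + 1) := pow_le_pow_of_le_one hr0.le hr1.le (by omega)
  have hsize : (((Fintype.card (Fin (2 * i + 1) × Fin (2 * i + 1)) +
      Fintype.card (Fin (2 * i + 1 + 1) × Fin (2 * i + 1 - 1))) * T i : ℕ) : ℝ) ≤ 9 * A * ((i + 1 : ℕ) : ℝ) ^ (m + 2) := by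
    simp only [Fintype.card_prod, Fintype.card_fin, Nat.add_sub_cancel]
    have hTi := hAm i
    have hT0 : 0 ≤ (T i : ℝ) := Nat.cast_nonneg _
    have hpoly : (((2 * i + 1) * (2 * i + 1) + (2 * i + 1 + 1) * (2 * i) : ℕ) : ℝ) ≤ 9 * ((i + 1 : ℕ) : ℝ) ^ 2 := by
      push_cast
      nlinarith [(Nat.cast_nonneg i : (0 : ℝ) ≤ i)]
    calc ((((2 * i + 1) * (2 * i + 1) + (2 * i + 1 + 1) * (2 * i)) * T i : ℕ) : ℝ)
        = (((2 * i + 1) * (2 * i + 1) + (2 * i + 1 + 1) * (2 * i) : ℕ) : ℝ) * (T i : ℝ) := by push_cast; ring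
      _ ≤ 9 * ((i + 1 : ℕ) : ℝ) ^ 2 * (A * ((i : ℝ) + 1) ^ m) := mul_le_mul hpoly hTi hT0 (by positivity)
      _ = 9 * A * ((i + 1 : ℕ) : ℝ) ^ (m + 2) := by push_cast; ring
  have hP0 : 0 ≤ 9 * A * ((i + 1 : ℕ) : ℝ) ^ (m + 2) := by positivity
  calc _ ≤ 9 * A * ((i + 1 : ℕ) : ℝ) ^ (m + 2) * r ^ (2 * i + 1) := mul_le_mul_of_nonneg_right hsize hrk
    _ ≤ 9 * A * ((i + 1 : ℕ) : ℝ) ^ (m + 2) * r ^ (i + 1) := mul_le_mul_of_nonneg_left hrle hP0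
    _ = 9 * A * (((i + 1 : ℕ) : ℝ) ^ (m + 2) * r ^ (i + 1)) := by ring

/-- The same growth for the `Z`-checks. [cite: DennisEtAl2002, §5.3] -/
theorem rsc_odd_phenom_growth_x {T : ℕ → ℕ} (hT : ToricCode.IsPolyBounded T) (r : ℝ) (hr0 : 0 < r) (hr1 : r < 1) :
    Tendsto (fun i => (((Fintype.card (Fin (2 * i + 1) × Fin (2 * i + 1)) +
      Fintype.card (Fin (2 * i + 1 - 1) × Fin (2 * i + 1 + 1))) * T i : ℕ) : ℝ) * r ^ (2 * i + 1)) atTop (𝓝 0) := by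
  refine (rsc_odd_phenom_growth_z hT r hr0 hr1).congr fun i => ?_
  simp only [Fintype.card_prod, Fintype.card_fin, Nat.mul_comm (2 * i + 1 + 1) (2 * i + 1 - 1)]

/-- **Phenomenological threshold `≥ p₀(5)` along the odd subfamily**, `Z` sector (noisy `X`-record), every polynomially bounded
schedule and every minimum-weight space-time decoder family (item 143's generic route). [cite: DumerKovalevPryadko2015, Thm 3 with p. 5]
[cite: DennisEtAl2002, §5.3 (p = q)] -/
theorem rsc_odd_z_phenom_isThresholdLowerBound {T : ℕ → ℕ} (hT : ToricCode.IsPolyBounded T)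
    (D : ∀ i, CSSPhenom.STDecoder (Fin (2 * i + 1 + 1) × Fin (2 * i + 1 - 1)) (Fin (2 * i + 1) × Fin (2 * i + 1)) (T i))
    (hD : ∀ i, (D i).IsMinWeight (CSSPhenom.stSyn (rscOddCode i).HX (T i)) (CSSPhenom.stCycles (rscOddCode i).HX (T i))
      hammingNorm) :
    IsThresholdLowerBound (zPhenomFailureFamily rscOddCode T D) (thresholdValue 5) := by
  have h := z_phenom_isThresholdLowerBound_of_rowWeight rscOddCode T D hD (w := 4)
    (fun i x => card_rowSupp_HX_le (2 * i + 1) x) (fun i => 2 * i + 1) (fun i => by omega) rsc_odd_le_weight_z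
    (rsc_odd_phenom_growth_z hT)
  norm_num at h
  exact h

/-- **Phenomenological threshold `≥ p₀(5)` along the odd subfamily**, `X` sector (noisy `Z`-record).
[cite: DumerKovalevPryadko2015, Thm 3 with p. 5] [cite: DennisEtAl2002, §5.3 (p = q)] -/
theorem rsc_odd_x_phenom_isThresholdLowerBound {T : ℕ → ℕ} (hT : ToricCode.IsPolyBounded T)
    (D : ∀ i, CSSPhenom.STDecoder (Fin (2 * i + 1 - 1) × Fin (2 * i + 1 + 1)) (Fin (2 * i + 1) × Fin (2 * i + 1)) (T i))
    (hD : ∀ i, (D i).IsMinWeight (CSSPhenom.stSyn (rscOddCode i).HZ (T i)) (CSSPhenom.stCycles (rscOddCode i).HZ (T i))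
      hammingNorm) :
    IsThresholdLowerBound (xPhenomFailureFamily rscOddCode T D) (thresholdValue 5) := by
  have h := x_phenom_isThresholdLowerBound_of_rowWeight rscOddCode T D hD (w := 4)
    (fun i z => card_rowSupp_HZ_le (2 * i + 1) z) (fun i => 2 * i + 1) (fun i => by omega) rsc_odd_le_weight_x
    (rsc_odd_phenom_growth_x hT)
  norm_num at h
  exact h

/-- ★ **`p_c^{ph} ≤ 1/4` for EVERY space-time decoder family of `RSC(2i+1)`**, `Z` sector (noisy `X`-record), every schedule
`T_i ≥ 1`: the two sectors have the same erasure behaviour (`rsc_odd_xErasureFamily_eq`), so `1/4 ≤ P^{ph}_{1/4}` throughout.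
[cite: DennisEtAl2002, §4.6 and §5.3] [cite: StaceBarrettDoherty2009, p. 2] -/
theorem rsc_odd_z_phenom_threshold_le_quarter {T : ℕ → ℕ} (hT : ∀ i, 0 < T i)
    (D : ∀ i, CSSPhenom.STDecoder (Fin (2 * i + 1 + 1) × Fin (2 * i + 1 - 1)) (Fin (2 * i + 1) × Fin (2 * i + 1)) (T i))
    {a : ℝ} (ha : IsThresholdLowerBound (zPhenomFailureFamily rscOddCode T D) a) : a ≤ 1 / 4 :=
  phenom_threshold_le_quarter_of_symm rscOddCode rscOdd_k_pos (fun i y => rsc_odd_xErasureFamily_eq i y) T hT D ha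

/-- ★ **`p_c^{ph} ≤ 1/4` for EVERY space-time decoder family of `RSC(2i+1)`**, `X` sector (noisy `Z`-record).
[cite: DennisEtAl2002, §4.6 and §5.3] [cite: StaceBarrettDoherty2009, p. 2] -/
theorem rsc_odd_x_phenom_threshold_le_quarter {T : ℕ → ℕ} (hT : ∀ i, 0 < T i)
    (D : ∀ i, CSSPhenom.STDecoder (Fin (2 * i + 1 - 1) × Fin (2 * i + 1 + 1)) (Fin (2 * i + 1) × Fin (2 * i + 1)) (T i))
    {a : ℝ} (ha : IsThresholdLowerBound (xPhenomFailureFamily rscOddCode T D) a) : a ≤ 1 / 4 :=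
  phenom_threshold_le_quarter_of_symm (fun i => (rscOddCode i).swap)
    (fun i => by rw [CSSCode.k_swap]; exact rscOdd_k_pos i) (fun i y => (rsc_odd_xErasureFamily_eq i y).symm) T hT D ha

/-- ★ **`p₀(5) ≤ p_c^{ph} ≤ 1/4`** (`.0101 < p_c^{ph} ≤ .25`) for the odd-distance rotated surface codes, `Z` sector: polynomially
bounded rounds `T_i ≥ 1`, any minimum-weight space-time decoder family for the floor, the ceiling for every decoder.
[cite: DumerKovalevPryadko2015, Thm 3 and p. 5] [cite: DennisEtAl2002, §4.6 and §5.3] -/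
theorem rsc_odd_z_phenom_accuracyThreshold_mem {T : ℕ → ℕ} (hT : ToricCode.IsPolyBounded T) (hT1 : ∀ i, 0 < T i)
    (D : ∀ i, CSSPhenom.STDecoder (Fin (2 * i + 1 + 1) × Fin (2 * i + 1 - 1)) (Fin (2 * i + 1) × Fin (2 * i + 1)) (T i))
    (hD : ∀ i, (D i).IsMinWeight (CSSPhenom.stSyn (rscOddCode i).HX (T i)) (CSSPhenom.stCycles (rscOddCode i).HX (T i))
      hammingNorm) :
    thresholdValue 5 ≤ accuracyThreshold (zPhenomFailureFamily rscOddCode T D) ∧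
      accuracyThreshold (zPhenomFailureFamily rscOddCode T D) ≤ 1 / 4 :=
  ⟨le_accuracyThreshold (rsc_odd_z_phenom_isThresholdLowerBound hT D hD) ((thresholdValue_le_half 5).trans (by norm_num)),
    rsc_odd_z_phenom_threshold_le_quarter hT1 D (isThresholdLowerBound_accuracyThreshold _)⟩

/-- ★ **`p₀(5) ≤ p_c^{ph} ≤ 1/4`**, `X` sector of the odd-distance rotated surface codes.
[cite: DumerKovalevPryadko2015, Thm 3 and p. 5] [cite: DennisEtAl2002, §4.6 and §5.3] -/
theorem rsc_odd_x_phenom_accuracyThreshold_mem {T : ℕ → ℕ} (hT : ToricCode.IsPolyBounded T) (hT1 : ∀ i, 0 < T i)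
    (D : ∀ i, CSSPhenom.STDecoder (Fin (2 * i + 1 - 1) × Fin (2 * i + 1 + 1)) (Fin (2 * i + 1) × Fin (2 * i + 1)) (T i))
    (hD : ∀ i, (D i).IsMinWeight (CSSPhenom.stSyn (rscOddCode i).HZ (T i)) (CSSPhenom.stCycles (rscOddCode i).HZ (T i))
      hammingNorm) :
    thresholdValue 5 ≤ accuracyThreshold (xPhenomFailureFamily rscOddCode T D) ∧
      accuracyThreshold (xPhenomFailureFamily rscOddCode T D) ≤ 1 / 4 :=
  ⟨le_accuracyThreshold (rsc_odd_x_phenom_isThresholdLowerBound hT D hD) ((thresholdValue_le_half 5).trans (by norm_num)),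
    rsc_odd_x_phenom_threshold_le_quarter hT1 D (isThresholdLowerBound_accuracyThreshold _)⟩

end Summit.Ventures.QEC.Thresholds
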